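import Summits.Ventures.AbcSig.Rows.TemplateAB2
import Summits.Ventures.AbcSig.Levels.N38
import Summits.Ventures.AbcSig.Levels.N2432

/-!
# Venture AbcSig — ROW `C2aL19A1AB`: `19^m·xⁿ + 2^a·yⁿ = z²` (SECOND coefficient distribution of the cell; the distribution `xⁿ + 2^a·19^m·yⁿ = z²` is `Rows/C2aL19A1.lean`), class `a 1` (GENERATED by plean/leanrow.py)

HONEST FRAMING. A row of a COMPUTATION cell (`pub-abcsig`); a CONDITIONAL theorem, no claim on ABC or any summit.
Hypotheses: `BS04Package` (CITED), `DataComplete` at levels [38, 2432] (COMPUTED, two-engine certified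
level files), and the listed per-orbit exclusions `hX_…` (CITED — e.g. the cell's M6 Eisenstein certificates; the
row's R5 cell names each). Everything else is kernel-checked (`Rows/TemplateAB.lean`, `Levels/N….lean` — the SAME level files as the first distribution). Exponent
range: prime `n ≥ 11`, `n ≠ 19`, n ∉ [11]; `B = 2^a 19^m` with `a, m < n` (n-th-power free).
Row of record:  (sha256 ; SIGNED 2026-08-22T09:24:07Z by referee (ref-g5)); its R0: THEOREM for primes n >= 11, n not in [11]; the survivors [11] need M4 (Kraus) / stay open — class: REPRODUCTION candidate (AB = 2·19^m cell of BS04 Thm 1.3 seco. Exponents left open by the row of record are excluded here via ; kernel-sieve residuals the row of record closes by a cell module (M6 Eisenstein / M4 Kraus certificates) appear as CITED hypotheses .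
-/

namespace Summit.Ventures.AbcSig

/-- Row `C2aL19A1AB`: second coefficient distribution `19^m·xⁿ + 2^a·yⁿ = z²` (see module docstring). -/
theorem row_C2aL19A1AB (M : NewformModel) (hP : M.BS04Package)
    (hD38 : M.DataComplete 38 level38Orbits) (hD2432 : M.DataComplete 2432 level2432Orbits)
    (n : ℕ) (hn : n.Prime) (hmin : 11 ≤ n) (hnℓ : n ≠ 19) (hres : n ∉ ([11] : List ℕ)) (m : ℕ) (hm : 1 ≤ m) (hmn : m < n)
    
    (x y z : ℤ) (hxy1 : x * y ≠ 1) (hxy2 : x * y ≠ -1) : ¬ IsPrimitiveSolution (19 ^ m) (2 ^ 1) 1 n x y z := by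
  have hℓ : Nat.Prime 19 := by norm_num
  have h7 : 7 ≤ n := by omega
  have hS38 :=
    (level38_sieve n hn h7 (fun o => M.Excludes 38 o (famAB (19 ^ m) (2 ^ 1) n (fun _ _ => True))))
  have hS2432 :=
    (level2432_sieve n hn h7 (fun o => M.Excludes 2432 o (famAB (19 ^ m) (2 ^ 1) n (fun _ _ => True))) (fun h => absurd h (by simp only [List.mem_cons, List.not_mem_nil, or_false] at hres ⊢; omega)) (fun h => absurd h (by simp only [List.mem_cons, List.not_mem_nil, or_false] at hres ⊢; omega)) (fun h => absurd h (by simp only [List.mem_cons, List.not_mem_nil, or_false] at hres ⊢; omega)) (fun h => absurd h (by simp only [List.mem_cons, List.not_mem_nil, or_false] at hres ⊢; omega)))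
  exact rowC2aAB_a1 19 hℓ (by norm_num) M hP n hn h7 hnℓ hD2432 hD38 m hm hmn
    hS2432
    hS38 x y z hxy1 hxy2

end Summit.Ventures.AbcSig
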